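import Summits.NavierStokesRegularity.NavierStokesRegularity.Theorems.AdaptedFrequencyAdaptedFrequencyConvergesStubKernelCalculusCore
import Literature.Analysis.FluidPDE.LerayHopf
import Literature.Analysis.FluidPDE.SuitableWeak
import Literature.Analysis.FluidPDE.NSWave0
import Literature.Analysis.FluidPDE.TaoEnstrophyLocalisation
import Literature.Analysis.FluidPDE.VorticityEquation
import Literature.Analysis.FluidPDE.TaoLocalisationHolds
import Literature.Analysis.FluidPDE.LerayLocalRegularH1Proofs
import Literature.Analysis.UnboundedOperators.HeatKernelGradient

/-! # Kernel calculus III: differentiability of the adapted enstrophy — crux stmt-NavierStokesRegularity-10493 (`AdaptedFrequency.AdaptedFrequencyConverges`), line tauberian-omega-limit, stub stub_kernelCalculus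

File 3/3 for the registered stub `stub_kernelCalculus` of the line's skeleton
(`--supports stmt-NavierStokesRegularity-10493`). **What is proved.**
`kernelCalculus_hasDerivAt_adaptedEnstrophy_of_bounds`: for a classical Navier–Stokes solution
`(u, p)` on `[0, T) × ℝ³`, an adapted backward kernel `G` of `∂ₜ + u·∇ − νΔ` on `[t₀, T)`
(`IsAdaptedBackwardKernel`) which is Gaussian-comparable (`IsGaussianComparable`), and a window
`(a, b)`, `0 ≤ a`, `t₀ ≤ a`, `b < T`, on which `u, Du, D²u, D³u` are bounded, the adapted enstrophy
`H = adaptedEnstrophy u G = ∫ ‖curl u‖² G` has at every `t ∈ (a, b)` the derivative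
`H′(t) = ∫ (∂ₜ + u·∇ − νΔ)‖ω‖² · G(t)`, `ω = curl u` (the transport-free first variation of file
2/3 with `q = ‖ω‖²`; the bound on `∂ₜ‖ω‖²` comes from the vorticity equation
`∂ₜω = νΔω − (u·∇)ω + (ω·∇)u`, tree `IsClassicalNSSolutionOn.vorticity_eq`, which eliminates the
pressure; the Gaussian upper bound supplies the integrable majorant on the window). Then
`stub_kernelCalculus`, EXACTLY as registered: under the crux hypotheses, `H` is differentiable at
every `t ∈ (t₀, T)` (so `t₁ = t₀`): on the closed slab `[0, (t + T)/2]` the solution is classical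
with energy bounded by the Leray–Hopf inequality, so all its Sobolev norms are bounded (Tao 2013,
Cor. 11.1, tree theorem `tao2011_hasBoundedSobolevNormsOn_holds`) and all derivatives of `u` are
bounded (Sobolev imbedding, `exists_forall_norm_iteratedFDeriv_le_of_hasBoundedSobolevNormsOn`).
The Type-I and singularity hypotheses of the stub are not used. Sources: C.-C. Poon, Comm. PDE 21
(1996) (first variation of the parabolic frequency); A. Friedman, *PDE of parabolic type* (1964),
Ch. 1 §8 (adjoint equation); T. Tao, Anal. PDE 6 (2013), Cor. 11.1.
-/

noncomputable section

open scoped Topology InnerProductSpace RealInnerProductSpace Laplacian ContDiff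
open Literature.Analysis.FluidPDE Set Filter MeasureTheory Function Metric

namespace Summit.NavierStokesRegularity.NavierStokesRegularity.Theorems.AdaptedFrequencyConverges.TauberianOmegaLimit

section R3

/-- **Kernel calculus for the adapted enstrophy, with explicit bounds.** Let `(u, p)` be a
classical Navier–Stokes solution on `[0, T) × ℝ³`, `G` an adapted backward kernel of
`∂ₜ + u·∇ − νΔ` on `[t₀, T)` which is Gaussian-comparable about `(T, x₀)`, and `(a, b)` a time
window with `0 ≤ a`, `t₀ ≤ a`, `b < T` on which `u`, `Du`, `D²u`, `D³u` are bounded by `K`. Then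
`H = adaptedEnstrophy u G` is differentiable at every `t ∈ (a, b)`, with the transport-free first
variation `H′(t) = ∫ (∂ₜ + u·∇ − νΔ)‖ω‖² G(t)`, `ω = curl u` (the time derivative of `‖ω‖²` being
bounded through the vorticity equation `∂ₜω = νΔω − (u·∇)ω + (ω·∇)u`, which eliminates the
pressure). -/
theorem kernelCalculus_hasDerivAt_adaptedEnstrophy_of_bounds {ν T t₀ a b K : ℝ}
    {u : ℝ → EuclideanSpace ℝ (Fin 3) → EuclideanSpace ℝ (Fin 3)}
    {p : ℝ → EuclideanSpace ℝ (Fin 3) → ℝ} {x₀ : EuclideanSpace ℝ (Fin 3)}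
    {G : ℝ → EuclideanSpace ℝ (Fin 3) → ℝ}
    (hcl : IsClassicalNSSolutionOn (Ico 0 T) ν 0 u p)
    (hG : IsAdaptedBackwardKernel ν u (Ico t₀ T) T x₀ G)
    (hcmp : IsGaussianComparable G (Ico t₀ T) T x₀) (h0a : 0 ≤ a) (hta : t₀ ≤ a) (hbT : b < T)
    (hU : ∀ t ∈ Ioo a b, ∀ x, ‖u t x‖ ≤ K)
    (hD : ∀ k : ℕ, 1 ≤ k → k ≤ 3 → ∀ t ∈ Ioo a b, ∀ x, ‖iteratedFDeriv ℝ k (u t) x‖ ≤ K)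
    {t : ℝ} (ht : t ∈ Ioo a b) :
    HasDerivAt (adaptedEnstrophy u G)
      (∫ x, (deriv (fun s => ‖curl (u s) x‖ ^ 2) t +
        fderiv ℝ (fun y => ‖curl (u t) y‖ ^ 2) x (u t x) -
        ν * (Δ (fun y => ‖curl (u t) y‖ ^ 2)) x) * G t x) t := by
  have hab : a < b := ht.1.trans ht.2
  have hS₀0 : Ioo a b ⊆ Ico 0 T := fun s hs => ⟨h0a.trans hs.1.le, hs.2.trans hbT⟩
  have hS₀S : Ioo a b ⊆ Ico t₀ T := fun s hs => ⟨hta.trans hs.1.le, hs.2.trans hbT⟩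
  have hnhds : ∀ s ∈ Ioo a b, Ico 0 T ∈ 𝓝 s := fun s hs =>
    mem_of_superset (isOpen_Ioo.mem_nhds hs) hS₀0
  have hK0 : 0 ≤ K := (norm_nonneg _).trans (hU t ht 0)
  -- smoothness of `u`, of the vorticity and of `q = ‖ω‖²`
  have hu : IsSmoothSpaceTimeOn (Ioo a b) u := hcl.smooth_velocity.mono hS₀0
  have hω : IsSmoothSpaceTimeOn (Ioo a b) fun s x => curl (u s) x :=
    (hu.isSmoothSpaceTimeOn_fderiv_of_isOpen isOpen_Ioo).clm curlCLM
  have hqinf : IsSmoothSpaceTimeOn (Ioo a b) fun s x => ‖curl (u s) x‖ ^ 2 :=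
    ContDiffOn.congr (hω.inner hω) fun z _ => (real_inner_self_eq_norm_sq _).symm
  have hcast : ∀ j : ℕ, (j : WithTop ℕ∞) + 1 ≤ ∞ := fun j => by
    exact_mod_cast (le_top : ((j + 1 : ℕ) : ℕ∞) ≤ ⊤)
  have hq : ContDiffOn ℝ 2 (uncurry fun s x => ‖curl (u s) x‖ ^ 2) (Ioo a b ×ˢ univ) :=
    hqinf.of_le (by norm_cast)
  have hus : ∀ s ∈ Ioo a b, ContDiff ℝ ∞ (u s) := fun s hs => hcl.contDiff_velocity (hS₀0 hs)
  have hωs : ∀ s ∈ Ioo a b, ContDiff ℝ 2 (curl (u s)) := fun s hs => by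
    rw [curl_eq_curlCLM_comp]
    exact curlCLM.contDiff.comp ((hus s hs).fderiv_right (m := 2) (hcast 2))
  -- bounds on the vorticity and its derivatives
  obtain ⟨κ, hκ⟩ : ∃ κ : ℝ, κ = ‖curlCLM‖ := ⟨_, rfl⟩
  have hκ0 : 0 ≤ κ := by rw [hκ]; exact norm_nonneg curlCLM
  have hκK : 0 ≤ κ * K := mul_nonneg hκ0 hK0
  have hωk : ∀ k ≤ 2, ∀ s ∈ Ioo a b, ∀ x, ‖iteratedFDeriv ℝ k (curl (u s)) x‖ ≤ κ * K := by
    intro k hk s hs x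
    rw [curl_eq_curlCLM_comp]
    have hf : ContDiff ℝ k (fderiv ℝ (u s)) := (hus s hs).fderiv_right (m := k) (hcast k)
    refine (curlCLM.norm_iteratedFDeriv_comp_left hf.contDiffAt le_rfl).trans ?_
    rw [norm_iteratedFDeriv_fderiv, ← hκ]
    exact mul_le_mul_of_nonneg_left (hD (k + 1) (by omega) (by omega) s hs x) hκ0
  have hω0 : ∀ s ∈ Ioo a b, ∀ x, ‖curl (u s) x‖ ≤ κ * K := fun s hs x => by
    simpa using hωk 0 (by norm_num) s hs x
  have hqK : ∀ k ≤ 2, ∀ s ∈ Ioo a b, ∀ x,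
      ‖iteratedFDeriv ℝ k (fun y => ‖curl (u s) y‖ ^ 2) x‖ ≤ 4 * (κ * K) ^ 2 := by
    intro k hk s hs x
    have hfun : (fun y => ‖curl (u s) y‖ ^ 2) =
        fun y => innerSL ℝ (curl (u s) y) (curl (u s) y) := by
      funext y; rw [innerSL_apply_apply, real_inner_self_eq_norm_sq]
    rw [hfun]
    refine (ContinuousLinearMap.norm_iteratedFDeriv_le_of_bilinear (innerSL ℝ) (hωs s hs)
      (hωs s hs) x (n := k) (by exact_mod_cast hk)).trans ?_
    calc ‖innerSL ℝ (E := EuclideanSpace ℝ (Fin 3))‖ *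
          ∑ i ∈ Finset.range (k + 1), (k.choose i : ℝ) *
            ‖iteratedFDeriv ℝ i (curl (u s)) x‖ * ‖iteratedFDeriv ℝ (k - i) (curl (u s)) x‖
        ≤ 1 * ∑ i ∈ Finset.range (k + 1), (k.choose i : ℝ) * (κ * K) * (κ * K) := by
          refine mul_le_mul (norm_innerSL_le ℝ) (Finset.sum_le_sum fun i hi => ?_)
            (Finset.sum_nonneg fun i _ => by positivity) zero_le_one
          have hi' : i ≤ k := Nat.lt_succ_iff.mp (Finset.mem_range.mp hi)
          have h1 := hωk i (hi'.trans hk) s hs x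
          have h2 := hωk (k - i) ((Nat.sub_le k i).trans hk) s hs x
          gcongr
      _ = 2 ^ k * (κ * K) ^ 2 := by
          rw [one_mul, ← Finset.sum_mul, ← Finset.sum_mul]
          have h := Nat.sum_range_choose k
          have h' : ∑ i ∈ Finset.range (k + 1), (k.choose i : ℝ) = 2 ^ k := by exact_mod_cast h
          rw [h']; ring
      _ ≤ 4 * (κ * K) ^ 2 := by
          gcongr
          calc (2 : ℝ) ^ k ≤ 2 ^ 2 := pow_le_pow_right₀ one_le_two hk
            _ = 4 := by norm_num
  -- the time derivative of `‖ω‖²` through the vorticity equation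
  have hcurl0 : ∀ s ∈ Ico 0 T, ∀ x : EuclideanSpace ℝ (Fin 3),
      curl ((0 : ℝ → EuclideanSpace ℝ (Fin 3) → EuclideanSpace ℝ (Fin 3)) s) x = 0 := fun s _ x =>
    curl_eq_zero_of_fderiv_eq_zero (by simp)
  have hclos : Ico 0 T ⊆ closure (interior (Ico (0 : ℝ) T)) := by
    have hT : (0 : ℝ) < T := (h0a.trans_lt hab).trans hbT
    rw [interior_Ico, closure_Ioo hT.ne]; exact Ico_subset_Icc_self
  have hqt : ∀ s ∈ Ioo a b, ∀ x, |deriv (fun r => ‖curl (u r) x‖ ^ 2) s| ≤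
      2 * (κ * K) * (2 * κ * K * K + |ν| * (3 * (κ * K))) := by
    intro s hs x
    -- `∂ₜω` from the vorticity equation
    have hωline := hω.hasDerivAt_timeLine isOpen_Ioo hs x
    have hveq := hcl.vorticity_eq (uniqueDiffOn_Ico 0 T) hclos hcurl0 (hS₀0 hs) x
    simp only [vorticity_apply, timeDerivWithin_apply, convect_apply] at hveq
    rw [derivWithin_of_mem_nhds (hnhds s hs)] at hveq
    have hderiv : deriv (fun r => curl (u r) x) s = fderiv ℝ (u s) x (curl (u s) x) +
        ν • (Δ (curl (u s))) x - fderiv ℝ (curl (u s)) x (u s x) := by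
      rw [eq_sub_iff_add_eq]; exact hveq
    have hbd : ‖deriv (fun r => curl (u r) x) s‖ ≤ 2 * κ * K * K + |ν| * (3 * (κ * K)) := by
      rw [hderiv]
      have h1 : ‖fderiv ℝ (u s) x (curl (u s) x)‖ ≤ K * (κ * K) := by
        refine (ContinuousLinearMap.le_opNorm _ _).trans (mul_le_mul ?_ (hω0 s hs x)
          (norm_nonneg _) hK0)
        rw [← norm_iteratedFDeriv_one]; exact hD 1 le_rfl (by norm_num) s hs x
      have h2 : ‖ν • (Δ (curl (u s))) x‖ ≤ |ν| * (3 * (κ * K)) := by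
        rw [norm_smul, Real.norm_eq_abs]
        refine mul_le_mul_of_nonneg_left ((kernelCalculus_norm_laplacian_le _ x).trans ?_)
          (abs_nonneg ν)
        rw [finrank_euclideanSpace_fin, Nat.cast_ofNat]
        exact mul_le_mul_of_nonneg_left (hωk 2 le_rfl s hs x) (by norm_num)
      have h3 : ‖fderiv ℝ (curl (u s)) x (u s x)‖ ≤ κ * K * K := by
        refine (ContinuousLinearMap.le_opNorm _ _).trans (mul_le_mul ?_ (hU s hs x)
          (norm_nonneg _) hκK)
        rw [← norm_iteratedFDeriv_one]; exact hωk 1 (by norm_num) s hs x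
      have e1 := norm_sub_le (fderiv ℝ (u s) x (curl (u s) x) + ν • (Δ (curl (u s))) x)
        (fderiv ℝ (curl (u s)) x (u s x))
      have e2 := norm_add_le (fderiv ℝ (u s) x (curl (u s) x)) (ν • (Δ (curl (u s))) x)
      linarith
    -- `∂ₜ‖ω‖² = 2⟨ω, ∂ₜω⟩`
    have hinner := hωline.inner ℝ hωline
    have hfun : (fun r => ‖curl (u r) x‖ ^ 2) = fun r => ⟪curl (u r) x, curl (u r) x⟫ := by
      funext r; rw [real_inner_self_eq_norm_sq]
    rw [hfun, hinner.deriv, real_inner_comm, ← two_mul, abs_mul, abs_two]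
    have hfinal : |⟪deriv (fun r => curl (u r) x) s, curl (u s) x⟫| ≤
        (κ * K) * (2 * κ * K * K + |ν| * (3 * (κ * K))) := by
      refine (abs_real_inner_le_norm _ _).trans ?_
      rw [mul_comm (κ * K)]
      exact mul_le_mul hbd (hω0 s hs x) (norm_nonneg _) (by positivity)
    linarith
  -- the Gaussian majorant on the window
  obtain ⟨c₁, c₂, C₁, C₂, -, -, hC₁, hC₂, hcomp⟩ := hcmp
  have hTa : 0 < T - a := by linarith
  have hTb : 0 < T - b := by linarith
  obtain ⟨M, hMdef⟩ : ∃ M : EuclideanSpace ℝ (Fin 3) → ℝ, M = fun x =>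
      C₁ * (T - b) ^ (-(Module.finrank ℝ (EuclideanSpace ℝ (Fin 3)) : ℝ) / 2) *
        Real.exp (-(1 / (C₂ * (T - a))) * ‖x - x₀‖ ^ 2) := ⟨_, rfl⟩
  have hMi : Integrable M := by
    rw [hMdef]
    exact ((Literature.Analysis.UnboundedOperators.integrable_gaussian_of_pos
      (by positivity : 0 < 1 / (C₂ * (T - a)))).comp_sub_right x₀).const_mul _
  have hGM : ∀ s ∈ Ioo a b, ∀ x, G s x ≤ M x := by
    intro s hs x
    refine ((hcomp s (hS₀S hs) x).2).trans ?_
    rw [hMdef]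
    have hTs : 0 < T - s := by linarith [hs.2]
    have h1 : (T - s) ^ (-(Module.finrank ℝ (EuclideanSpace ℝ (Fin 3)) : ℝ) / 2) ≤
        (T - b) ^ (-(Module.finrank ℝ (EuclideanSpace ℝ (Fin 3)) : ℝ) / 2) :=
      Real.rpow_le_rpow_of_nonpos hTb (by linarith [hs.2]) (by
        rw [finrank_euclideanSpace_fin]; norm_num)
    have h2 : Real.exp (-(‖x - x₀‖ ^ 2) / (C₂ * (T - s))) ≤
        Real.exp (-(1 / (C₂ * (T - a))) * ‖x - x₀‖ ^ 2) := by
      rw [Real.exp_le_exp, neg_div, show -(1 / (C₂ * (T - a))) * ‖x - x₀‖ ^ 2 =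
        -(‖x - x₀‖ ^ 2 / (C₂ * (T - a))) by ring, neg_le_neg_iff]
      exact div_le_div_of_nonneg_left (sq_nonneg _) (by positivity)
        (mul_le_mul_of_nonneg_left (by linarith [hs.1]) hC₂.le)
    have h0 : 0 ≤ C₁ * (T - s) ^ (-(Module.finrank ℝ (EuclideanSpace ℝ (Fin 3)) : ℝ) / 2) :=
      mul_nonneg hC₁.le (Real.rpow_nonneg hTs.le _)
    calc C₁ * (T - s) ^ (-(Module.finrank ℝ (EuclideanSpace ℝ (Fin 3)) : ℝ) / 2) *
          Real.exp (-(‖x - x₀‖ ^ 2) / (C₂ * (T - s)))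
        ≤ C₁ * (T - s) ^ (-(Module.finrank ℝ (EuclideanSpace ℝ (Fin 3)) : ℝ) / 2) *
            Real.exp (-(1 / (C₂ * (T - a))) * ‖x - x₀‖ ^ 2) :=
          mul_le_mul_of_nonneg_left h2 h0
      _ ≤ C₁ * (T - b) ^ (-(Module.finrank ℝ (EuclideanSpace ℝ (Fin 3)) : ℝ) / 2) *
            Real.exp (-(1 / (C₂ * (T - a))) * ‖x - x₀‖ ^ 2) := by
          gcongr
  -- apply the core
  set Kq : ℝ := max (4 * (κ * K) ^ 2) (2 * (κ * K) * (2 * κ * K * K + |ν| * (3 * (κ * K))))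
  have key := kernelCalculus_hasDerivAt_integral_mul_kernel (K := Kq) (U := K) hG isOpen_Ioo hS₀S
    hMi hGM (fun s hs => (hus s hs).of_le (by norm_cast))
    (fun s hs => hcl.divFree s (hS₀0 hs)) hU hq
    (fun k hk s hs x => (hqK k hk s hs x).trans (le_max_left _ _))
    (fun s hs x => (hqt s hs x).trans (le_max_right _ _)) ht
  exact key

/-- **Stub `stub_kernelCalculus`** of line `tauberian-omega-limit` (crux
`AdaptedFrequencyConverges`): near `T` the adapted enstrophy `H(t) = ∫ ‖curl u(t)‖² G(t)` of a
classical Leray–Hopf solution from a rapidly decaying datum against an adapted, Gaussian-comparable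
backward kernel is differentiable — in fact at every `t ∈ (t₀, T)`. Proof: on the closed slab
`[0, (t + T)/2]` all Sobolev norms of `u` are bounded (Tao 2013, Cor. 11.1,
`tao2011_hasBoundedSobolevNormsOn_holds`; energy bound from the Leray–Hopf inequality), hence all
derivatives of `u` are bounded there (Sobolev imbedding,
`exists_forall_norm_iteratedFDeriv_le_of_hasBoundedSobolevNormsOn`), and
`kernelCalculus_hasDerivAt_adaptedEnstrophy_of_bounds` applies on the window `(t₀, (t + T)/2)`.
(The Type-I and singularity hypotheses are not used.) -/
theorem stub_kernelCalculus :
    ∀ (ν T : ℝ) (u : ℝ → EuclideanSpace ℝ (Fin 3) → EuclideanSpace ℝ (Fin 3)) (p : ℝ → EuclideanSpace ℝ (Fin 3) → ℝ) (x₀ : EuclideanSpace ℝ (Fin 3)) (t₀ : ℝ) (G : ℝ → EuclideanSpace ℝ (Fin 3) → ℝ), 0 < ν → 0 < T → IsClassicalNSSolutionOn (Ico 0 T) ν 0 u p → IsLerayHopfOn T ν 0 (u 0) u → HasRapidSpatialDecay (u 0) → IsTypeIBlowup u T → t₀ ∈ Ico 0 T → (∀ r : ℝ, 0 < r → eLpNorm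 (Function.uncurry u) ⊤ (volume.restrict (parabolicCylinder r (T, x₀))) = ⊤) → IsAdaptedBackwardKernel ν u (Ico t₀ T) T x₀ G → IsGaussianComparable G (Ico t₀ T) T x₀ → ∃ t₁ ∈ Ico t₀ T, ∀ t ∈ Ioo t₁ T, DifferentiableAt ℝ (adaptedEnstrophy u G) t := by
  intro ν T u p x₀ t₀ G hν hT hcl hLH hdec _hTI ht₀ _hsing hG hcmp
  refine ⟨t₀, ⟨le_rfl, ht₀.2⟩, fun t ht => ?_⟩
  -- the closed slab `[0, b]`, `b = (t + T)/2`
  obtain ⟨b, hbdef⟩ : ∃ b : ℝ, b = (t + T) / 2 := ⟨_, rfl⟩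
  have htb : t < b := by rw [hbdef]; linarith [ht.2]
  have hbT : b < T := by rw [hbdef]; linarith [ht.2]
  have hb0 : 0 < b := (ht₀.1.trans_lt ht.1).trans htb
  have hcl' : IsClassicalNSSolutionOn (Icc 0 b) ν 0 u p :=
    hcl.mono (Icc_subset_Ico_right hbT) (uniqueDiffOn_Icc hb0)
  have hE : ∃ C : NNReal, ∀ s ∈ Icc 0 b, ∫⁻ x, ‖u s x‖ₑ ^ 2 ≤ C :=
    ⟨(2 * VectorCalculus.kineticEnergy (u 0)).toNNReal, fun s hs =>
      hLH.lintegral_enorm_sq_le hν.le ⟨hs.1, hs.2.trans hbT.le⟩⟩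
  have hH : HasBoundedSobolevNormsOn (Icc 0 b) u :=
    tao2011_hasBoundedSobolevNormsOn_holds hν hb0 hcl' hE hdec
  have hsm : ∀ s ∈ Icc 0 b, ContDiff ℝ ∞ (u s) := fun s hs => hcl'.contDiff_velocity hs
  obtain ⟨K₀, hK₀⟩ := exists_forall_norm_iteratedFDeriv_le_of_hasBoundedSobolevNormsOn hsm hH 0
  obtain ⟨K₁, hK₁⟩ := exists_forall_norm_iteratedFDeriv_le_of_hasBoundedSobolevNormsOn hsm hH 1
  obtain ⟨K₂, hK₂⟩ := exists_forall_norm_iteratedFDeriv_le_of_hasBoundedSobolevNormsOn hsm hH 2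
  obtain ⟨K₃, hK₃⟩ := exists_forall_norm_iteratedFDeriv_le_of_hasBoundedSobolevNormsOn hsm hH 3
  set K := max (max K₀ K₁) (max K₂ K₃)
  have hIoo : Ioo t₀ b ⊆ Icc 0 b := fun s hs => ⟨ht₀.1.trans hs.1.le, hs.2.le⟩
  have hU : ∀ s ∈ Ioo t₀ b, ∀ x, ‖u s x‖ ≤ K := fun s hs x => by
    have h := hK₀ s (hIoo hs) x
    rw [norm_iteratedFDeriv_zero] at h
    exact h.trans ((le_max_left _ _).trans (le_max_left _ _))
  have hD : ∀ k : ℕ, 1 ≤ k → k ≤ 3 → ∀ s ∈ Ioo t₀ b, ∀ x, ‖iteratedFDeriv ℝ k (u s) x‖ ≤ K := by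
    intro k hk1 hk3 s hs x
    interval_cases k
    · exact (hK₁ s (hIoo hs) x).trans ((le_max_right _ _).trans (le_max_left _ _))
    · exact (hK₂ s (hIoo hs) x).trans ((le_max_left _ _).trans (le_max_right _ _))
    · exact (hK₃ s (hIoo hs) x).trans ((le_max_right _ _).trans (le_max_right _ _))
  exact (kernelCalculus_hasDerivAt_adaptedEnstrophy_of_bounds hcl hG hcmp ht₀.1 le_rfl hbT hU hD
    ⟨ht.1, htb⟩).differentiableAt

end R3

end Summit.NavierStokesRegularity.NavierStokesRegularity.Theorems.AdaptedFrequencyConverges.TauberianOmegaLimit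

end
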